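import Summits.BirchSwinnertonDyer.BirchSwinnertonDyer.Theorems.QuadraticBranchSignedControlPlusEtaNonsurjUncongruentSevenTools
import Summits.BirchSwinnertonDyer.BirchSwinnertonDyer.Theorems.QuadraticBranchSignedControlPlusEtaNonsurjGoodFrobenius
import Literature.NumberTheory.EllipticCurves.ComplexMultiplicationDeuringFrobeniusProofs
import Literature.NumberTheory.EllipticCurves.SerreOpenImageDeterminantProofs
import Literature.NumberTheory.EllipticCurves.ModPIrreducibleCongruenceTransferProofs
import HarnessLib

/-!
# Route `QuadraticBranchSignedControl` (rung K8, cell `bsd-potss`): crux stmt-BirchSwinnertonDyer-19606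
# `PlusEtaMainConjectureNonsurj` — THE QUARTIC DOOR, PART I (Galois side): every curve with `j = 1728` is `ℚ̄`-isomorphic to `y² = x³ + x`
# equivariantly up to the automorphism `θ(x,y) = (−x, iy)` on `Gal(ℚ̄/ℚ(i))`; the `2 × 2` lemma `tr(MF)² = 4 det F − tr F²`

WHY. The `±` twist door of k8eta-c2 g14 (`…TwistedCongruenceTrace`) excludes anchors with `j ∉ {0, 1728}`; the rows of crux 19606 whose
Cartan field is `ℚ(i)` (h = 1) — `x = −3/7` at `p = 7` (anchored: `y² = x³ + 3x`, KO92) and `3P` at `p = 11` (anchor-free numerically) — have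
their possible anchors among the curves with `j = 1728`, i.e. the QUARTIC twists `y² = x³ + αx` of `E₀ : y² = x³ + x`, which the `±` door
cannot see. This file proves the quartic analogue: along a `ℚ̄`-isomorphism `A ≅ E₀` (`u⁴ = α`) an element `σ ∈ Γ_ℚ` FIXING `i` is
transported up to an automorphism `θ^k` of `E₀` (`θ(x, y) = (−x, iy)`, `θ² = −1`), so on `p`-torsion `tr ρ̄_A(σ) = tr(Θ^k ρ̄_{E₀}(σ))`; for a
`2 × 2` matrix `M` with `M² = −1` over a field in which `−1` is not a square (`𝔽_p`, `p ≡ 3 (mod 4)`) commuting with `F`: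
`tr(MF)² = 4 det F − tr(F)²`. Hence the door (Part II, `…QuarticTwistDoor`): `V[p] ≅ A[p]`, `j(A) = 1728`, `p ≡ 3 (mod 4)`, `ℓ ≡ 1 (mod 4)` a good prime of `V`:
`a_ℓ(V)² ≡ a_ℓ(E₀)²` or `a_ℓ(V)² ≡ 4ℓ − a_ℓ(E₀)² (mod p)` — Gauss's `a_ℓ ∈ {±2a, ±2b}`, `ℓ = a² + b²`, in the form the kernel can check.

* §1 `trace_mul_sq_of_mul_self_eq_neg_one` (2 × 2 matrices); §2 `iso_smul_quartic`, `iso_smul_quartic_neg`, `theta_theta` (the cases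
  `σ u = ±i·u` of the Galois behaviour of a `ℚ̄`-isomorphism `(u, 0, 0, 0)`, complementing the Deuring file's `iso_smul` / `iso_smul_neg`);
  §3 `a₆_eq_zero_of_j_eq_1728`, **`exists_iso_of_j_eq_1728`**. Part II (`…QuarticTwistDoor`): torsion restriction, the door
  `sq_frobeniusTrace_of_modPCongruent_of_j_eq_1728` and its count form.

HONEST FRAMING (cell `bsd-potss`, run/shared/lean/pub/bsd-potss/; FULL-BSD rank ≤ 1 programme): TOOL THEOREMS ONLY (no definition,
no named fact, no `sorry`, axioms standard). Nothing is booked; crux 19606 stays OPEN. Seat `bsd-potss-k8eta-c2` g15 (prover),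
`--supports stmt-BirchSwinnertonDyer-19606`.

References: [SilvermanAEC2009] X.5 Prop. 5.4 (twists by `Aut(E) = μ₄` for `j = 1728`), III.10, III.§7; [IrelandRosen1990] Ch. 18 §4
(`a_p` of `y² = x³ − Dx`); [Serre1981] §8.1 (238).
-/

set_option autoImplicit false
set_option linter.dupNamespace false

noncomputable section

open scoped Classical NumberField

open Field IsDedekindDomain NumberField WeierstrassCurve Literature.NumberTheory.EllipticCurves
  Literature.NumberTheory.GaloisRepresentations Rat.HeightOneSpectrum
open Literature.NumberTheory.EllipticCurves.DeuringLadic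
open Summit.BirchSwinnertonDyer.Rank1Residual.O6 (ModPCongruent)
open Summit.BirchSwinnertonDyer.BirchSwinnertonDyer.Rank1Residual.IntModel (integralModelInt_eq_of_map_eq map_mk_int minimalDiscriminantInt_eq)
open scoped Matrix
open Literature.NumberTheory.EllipticCurves.Rank1Residual.X11RankOneCertificates (discOf countPoints)

namespace Summit.BirchSwinnertonDyer.BirchSwinnertonDyer.Theorems.EtaCartanField

/-! ## §1 The `2 × 2` lemma: `M² = −1`, `−1` not a square, `MF = FM` ⟹ `tr(MF)² = 4 det F − tr(F)²` -/

/-- **Trace of `MF` for `M² = −1`.** Over a field `K` in which `−1` is not a square, if `M² = −1` and `MF = FM` (`2 × 2` matrices) then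
`tr(MF)² = 4·det F − tr(F)²` (`M` is not scalar, so `tr M = 0`, and `F ∈ K[M]`). [folklore] -/
theorem trace_mul_sq_of_mul_self_eq_neg_one {K : Type*} [Field K] {M F : Matrix (Fin 2) (Fin 2) K}
    (hM : M * M = -1) (hK : ¬ IsSquare (-1 : K)) (hMF : M * F = F * M) :
    (M * F).trace ^ 2 = 4 * F.det - F.trace ^ 2 := by
  obtain ⟨a, b, c, d, rfl⟩ : ∃ a b c d : K, M = !![a, b; c, d] :=
    ⟨M 0 0, M 0 1, M 1 0, M 1 1, by ext i j; fin_cases i <;> fin_cases j <;> rfl⟩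
  obtain ⟨e, f, g, h, rfl⟩ : ∃ e f g h : K, F = !![e, f; g, h] :=
    ⟨F 0 0, F 0 1, F 1 0, F 1 1, by ext i j; fin_cases i <;> fin_cases j <;> rfl⟩
  have m00 := congrFun (congrFun hM 0) 0
  have m01 := congrFun (congrFun hM 0) 1
  have m10 := congrFun (congrFun hM 1) 0
  have k00 := congrFun (congrFun hMF 0) 0
  have k01 := congrFun (congrFun hMF 0) 1
  have k10 := congrFun (congrFun hMF 1) 0
  simp only [Matrix.mul_apply, Fin.sum_univ_two, Matrix.of_apply, Matrix.cons_val', Matrix.cons_val_zero,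
    Matrix.cons_val_one, Matrix.cons_val_fin_one, Matrix.neg_apply, Matrix.one_apply_eq, Matrix.one_apply_ne,
    ne_eq, zero_ne_one, one_ne_zero, not_false_eq_true, neg_zero] at m00 m01 m10 k00 k01 k10
  -- `tr M = 0`: otherwise `b = c = 0` and `a² = −1`
  have had : a + d = 0 := by
    by_contra ht
    have hb : b = 0 := by
      have : b * (a + d) = 0 := by linear_combination m01
      rcases mul_eq_zero.mp this with h0 | h0
      · exact h0
      · exact absurd h0 ht
    have hc : c = 0 := by
      have : c * (a + d) = 0 := by linear_combination m10
      rcases mul_eq_zero.mp this with h0 | h0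
      · exact h0
      · exact absurd h0 ht
    exact hK ⟨a, by linear_combination -m00 + c * hb⟩
  have hd : d = -a := by linear_combination had
  subst hd
  simp only [Matrix.mul_fin_two, Matrix.trace_fin_two_of, Matrix.det_fin_two_of]
  grind

/-! ## §2 The automorphism `θ(x, y) = (−x, iy)` of `y² = x³ + a₄x` and the quartic Galois behaviour of `u⁴ = α` -/

section PointLevel

variable {X E : WeierstrassCurve ℚ}

/-- **Quartic Galois behaviour, case `σ u = i·u`.** Let `C = (u, 0, 0, 0)` over `ℚ̄` with `C • X = E`, `E` of the form `y² = x³ + a₄x`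
(`a₁ = a₂ = a₃ = a₆ = 0`), inducing `ι : X(ℚ̄) ≃ E(ℚ̄)`, `(x, y) ↦ (u⁻²x, u⁻³y)`; let `C_I = (I, 0, 0, 0)` with `I² = −1` (so `C_I • E = E`),
inducing the automorphism `θ : (x, y) ↦ (−x, I·y)` of `E(ℚ̄)`. If `σ u = I·u` then `θ (ι (σ P)) = σ (ι P)`.
[cite: SilvermanAEC2009, X.5 Prop. 5.4 and III.10] -/
theorem iso_smul_quartic (C : VariableChange (AlgebraicClosure ℚ))
    (hC : C • X.baseChange (AlgebraicClosure ℚ) = E.baseChange (AlgebraicClosure ℚ))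
    (hr : C.r = 0) (hs : C.s = 0) (ht : C.t = 0) {I : AlgebraicClosure ℚ} (hI : I ^ 2 = -1)
    (CI : VariableChange (AlgebraicClosure ℚ)) (hCIu : ((CI.u : (AlgebraicClosure ℚ)ˣ) : AlgebraicClosure ℚ) = I)
    (hCIr : CI.r = 0) (hCIs : CI.s = 0) (hCIt : CI.t = 0)
    (hCI : CI • E.baseChange (AlgebraicClosure ℚ) = E.baseChange (AlgebraicClosure ℚ))
    {σ : (AlgebraicClosure ℚ) ≃ₐ[ℚ] (AlgebraicClosure ℚ)} (hu : σ ((C.u : (AlgebraicClosure ℚ)ˣ) : AlgebraicClosure ℚ) = I * C.u)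
    (P : (X.baseChange (AlgebraicClosure ℚ)).toAffine.Point) :
    ((VariableChange.pointEquiv (E.baseChange (AlgebraicClosure ℚ)) CI).trans (Affine.Point.congrEquiv hCI))
      (((VariableChange.pointEquiv (X.baseChange (AlgebraicClosure ℚ)) C).trans (Affine.Point.congrEquiv hC)) (σ • P)) =
      σ • ((VariableChange.pointEquiv (X.baseChange (AlgebraicClosure ℚ)) C).trans (Affine.Point.congrEquiv hC)) P := by
  have hI4 : I ^ 4 = 1 := by rw [show (4 : ℕ) = 2 * 2 by norm_num, pow_mul, hI]; norm_num
  have hI0 : I ≠ 0 := by rintro rfl; norm_num at hI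
  rcases P with _ | ⟨x, y, hxy⟩
  · rw [← Affine.Point.zero_def, smul_zero, map_zero, map_zero, smul_zero]
  · obtain ⟨h1, e1⟩ := algEquiv_smul_some X σ hxy
    have e3 := pointEquiv_trans_congrEquiv_some C hC h1
    have e4 := pointEquiv_trans_congrEquiv_some C hC hxy
    rw [e1]
    erw [e3, e4]
    have e5 := pointEquiv_trans_congrEquiv_some CI hCI
      (hC ▸ (VariableChange.nonsingular_iff (X.baseChange (AlgebraicClosure ℚ)) C (σ x) (σ y)).mpr h1)
    erw [e5]
    obtain ⟨h2, e2⟩ := algEquiv_smul_some E σ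
      (hC ▸ (VariableChange.nonsingular_iff (X.baseChange (AlgebraicClosure ℚ)) C x y).mpr hxy)
    refine Eq.trans ?_ e2.symm
    have hu0 : ((C.u : (AlgebraicClosure ℚ)ˣ) : AlgebraicClosure ℚ) ≠ 0 := C.u.ne_zero
    have hI3 : I⁻¹ ^ 3 = I := by
      rw [inv_pow, inv_eq_iff_eq_inv, ← mul_right_inj' hI0, ← pow_succ', hI4, mul_inv_cancel₀ hI0]
    have hI2 : I⁻¹ ^ 2 = -1 := by rw [inv_pow, hI]; norm_num
    congr 1
    · simp only [VariableChange.toX_def, Units.val_inv_eq_inv_val, hCIu, hCIr, hr, map_mul, map_pow, map_inv₀,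
        hu, sub_zero, hI2]
      field_simp
      rw [hI]; ring
    · simp only [VariableChange.toX_def, VariableChange.toY_def, Units.val_inv_eq_inv_val, hCIu, hCIr, hCIs, hCIt, hr, hs, ht,
        map_mul, map_pow, map_inv₀, hu, sub_zero, zero_mul, hI3]
      field_simp
      rw [hI4]; ring

/-- **Quartic Galois behaviour, case `σ u = −i·u`**: with the notation of `iso_smul_quartic`, if `σ u = −I·u` then
`ι (σ P) = θ (σ (ι P))`. [cite: SilvermanAEC2009, X.5 Prop. 5.4 and III.10] -/
theorem iso_smul_quartic_neg (C : VariableChange (AlgebraicClosure ℚ))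
    (hC : C • X.baseChange (AlgebraicClosure ℚ) = E.baseChange (AlgebraicClosure ℚ))
    (hr : C.r = 0) (hs : C.s = 0) (ht : C.t = 0) {I : AlgebraicClosure ℚ} (hI : I ^ 2 = -1)
    (CI : VariableChange (AlgebraicClosure ℚ)) (hCIu : ((CI.u : (AlgebraicClosure ℚ)ˣ) : AlgebraicClosure ℚ) = I)
    (hCIr : CI.r = 0) (hCIs : CI.s = 0) (hCIt : CI.t = 0)
    (hCI : CI • E.baseChange (AlgebraicClosure ℚ) = E.baseChange (AlgebraicClosure ℚ))
    {σ : (AlgebraicClosure ℚ) ≃ₐ[ℚ] (AlgebraicClosure ℚ)} (hu : σ ((C.u : (AlgebraicClosure ℚ)ˣ) : AlgebraicClosure ℚ) = -(I * C.u))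
    (P : (X.baseChange (AlgebraicClosure ℚ)).toAffine.Point) :
    ((VariableChange.pointEquiv (X.baseChange (AlgebraicClosure ℚ)) C).trans (Affine.Point.congrEquiv hC)) (σ • P) =
      ((VariableChange.pointEquiv (E.baseChange (AlgebraicClosure ℚ)) CI).trans (Affine.Point.congrEquiv hCI))
        (σ • ((VariableChange.pointEquiv (X.baseChange (AlgebraicClosure ℚ)) C).trans (Affine.Point.congrEquiv hC)) P) := by
  have hI4 : I ^ 4 = 1 := by rw [show (4 : ℕ) = 2 * 2 by norm_num, pow_mul, hI]; norm_num
  have hI0 : I ≠ 0 := by rintro rfl; norm_num at hI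
  rcases P with _ | ⟨x, y, hxy⟩
  · rw [← Affine.Point.zero_def, smul_zero, map_zero, smul_zero, map_zero]
  · obtain ⟨h1, e1⟩ := algEquiv_smul_some X σ hxy
    have e3 := pointEquiv_trans_congrEquiv_some C hC h1
    have e4 := pointEquiv_trans_congrEquiv_some C hC hxy
    rw [e1]
    erw [e3, e4]
    obtain ⟨h2, e2⟩ := algEquiv_smul_some E σ
      (hC ▸ (VariableChange.nonsingular_iff (X.baseChange (AlgebraicClosure ℚ)) C x y).mpr hxy)
    have e5 := pointEquiv_trans_congrEquiv_some CI hCI h2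
    refine Eq.trans ?_ (congrArg
      (fun Q => ((VariableChange.pointEquiv (E.baseChange (AlgebraicClosure ℚ)) CI).trans (Affine.Point.congrEquiv hCI)) Q) e2).symm
    erw [e5]
    have hu0 : ((C.u : (AlgebraicClosure ℚ)ˣ) : AlgebraicClosure ℚ) ≠ 0 := C.u.ne_zero
    have hI3 : I⁻¹ ^ 3 = I := by
      rw [inv_pow, inv_eq_iff_eq_inv, ← mul_right_inj' hI0, ← pow_succ', hI4, mul_inv_cancel₀ hI0]
    have hI2 : I⁻¹ ^ 2 = -1 := by rw [inv_pow, hI]; norm_num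
    congr 1
    · simp only [VariableChange.toX_def, Units.val_inv_eq_inv_val, hCIu, hCIr, hr, map_mul, map_pow, map_inv₀,
        hu, sub_zero, hI2]
      field_simp
      rw [hI]; ring
    · simp only [VariableChange.toX_def, VariableChange.toY_def, Units.val_inv_eq_inv_val, hCIu, hCIr, hCIs, hCIt, hr, hs, ht,
        map_mul, map_pow, map_inv₀, hu, sub_zero, zero_mul, hI3]
      field_simp
      rw [hI]; ring

/-- **`θ² = −1`**: the automorphism `θ : (x, y) ↦ (−x, I·y)` of `y² = x³ + a₄x` (`a₁ = a₃ = 0`, `I² = −1`) satisfies `θ (θ P) = −P`.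
[cite: SilvermanAEC2009, III.10] -/
theorem theta_theta (ha₁ : E.a₁ = 0) (ha₃ : E.a₃ = 0) {I : AlgebraicClosure ℚ} (hI : I ^ 2 = -1)
    (CI : VariableChange (AlgebraicClosure ℚ)) (hCIu : ((CI.u : (AlgebraicClosure ℚ)ˣ) : AlgebraicClosure ℚ) = I)
    (hCIr : CI.r = 0) (hCIs : CI.s = 0) (hCIt : CI.t = 0)
    (hCI : CI • E.baseChange (AlgebraicClosure ℚ) = E.baseChange (AlgebraicClosure ℚ))
    (P : (E.baseChange (AlgebraicClosure ℚ)).toAffine.Point) :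
    ((VariableChange.pointEquiv (E.baseChange (AlgebraicClosure ℚ)) CI).trans (Affine.Point.congrEquiv hCI))
      (((VariableChange.pointEquiv (E.baseChange (AlgebraicClosure ℚ)) CI).trans (Affine.Point.congrEquiv hCI)) P) = -P := by
  have hI4 : I ^ 4 = 1 := by rw [show (4 : ℕ) = 2 * 2 by norm_num, pow_mul, hI]; norm_num
  have hI0 : I ≠ 0 := by rintro rfl; norm_num at hI
  rcases P with _ | ⟨x, y, hxy⟩
  · rw [← Affine.Point.zero_def, map_zero, map_zero, neg_zero]
  · have e4 := pointEquiv_trans_congrEquiv_some CI hCI hxy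
    erw [e4]
    have e5 := pointEquiv_trans_congrEquiv_some CI hCI
      (hCI ▸ (VariableChange.nonsingular_iff (E.baseChange (AlgebraicClosure ℚ)) CI x y).mpr hxy)
    erw [e5]
    rw [Affine.Point.neg_some]
    have hI3 : I⁻¹ ^ 3 = I := by
      rw [inv_pow, inv_eq_iff_eq_inv, ← mul_right_inj' hI0, ← pow_succ', hI4, mul_inv_cancel₀ hI0]
    have hI2 : I⁻¹ ^ 2 = -1 := by rw [inv_pow, hI]; norm_num
    congr 1
    · simp only [VariableChange.toX_def, Units.val_inv_eq_inv_val, hCIu, hCIr, sub_zero, hI2]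
      ring
    · simp only [Affine.negY, VariableChange.toX_def, VariableChange.toY_def, Units.val_inv_eq_inv_val, hCIu, hCIr, hCIs, hCIt,
        sub_zero, zero_mul, hI3, hI2, baseChange, map_a₁, map_a₃, ha₁, ha₃, map_zero]
      linear_combination y * hI

end PointLevel

/-! ## §3 Every curve with `j = 1728` is `ℚ̄`-isomorphic to `E₀ : y² = x³ + x`, equivariantly up to `θ^k` on `Gal(ℚ̄/ℚ(i))` -/

/-- For a short model `y² = x³ + Ax + B` (elliptic, characteristic `0`): `j = 1728` forces `B = 0` (`j = 6912A³/(4A³ + 27B²)`).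
Silverman, *AEC*, X.5 Prop. 5.4 (ii). [cite: SilvermanAEC2009, X.5 Prop. 5.4] -/
theorem a₆_eq_zero_of_j_eq_1728 {F : Type*} [Field F] [CharZero F] (S : WeierstrassCurve F) [S.IsElliptic] [S.IsShortNF]
    (h : S.j = 1728) : S.a₆ = 0 := by
  have hD := four_mul_a₄_cube_add_ne_zero S
  rw [j_of_isShortNF, div_eq_iff hD] at h
  have h' : (46656 : F) * S.a₆ ^ 2 = 0 := by linear_combination -h
  have h46656 : (46656 : F) ≠ 0 := by norm_num
  rcases mul_eq_zero.mp h' with h0 | h0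
  · exact absurd h0 h46656
  · exact pow_eq_zero_iff (n := 2) (by norm_num) |>.mp h0

/-- **Every elliptic curve over `ℚ` with `j = 1728` is `ℚ̄`-isomorphic to `E₀ = [0,0,0,1,0]` (`y² = x³ + x`), and for every
`g ∈ Γ_ℚ` FIXING `i` the isomorphism `ι` is equivariant up to an automorphism of `E₀`**: `ι ∘ g = τ_g ∘ g ∘ ι` with `τ_g ∈ {1, −1, θ⁻¹, θ}`,
`θ(x, y) = (−x, iy)` (`θ² = −1`, `θ` commutes with every `g` fixing `i`). Construction: the short model `y² = x³ + Ax` of the curve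
(`toShortNF`, `a₆ = 0` by `j = 1728`) and `u = α` with `α⁴ = A`; `g α = ζ α` with `ζ⁴ = 1`, i.e. `ζ ∈ {±1, ±i}`.
[cite: SilvermanAEC2009, X.5 Prop. 5.4 and Cor. 5.4.1, III.10] -/
theorem exists_iso_of_j_eq_1728 {W : WeierstrassCurve ℚ} [W.IsElliptic] (hj : W.j = 1728)
    {I : AlgebraicClosure ℚ} (hI : I ^ 2 = -1) :
    ∃ (ι : W.geomPoints ≃+ (⟨0, 0, 0, 1, 0⟩ : WeierstrassCurve ℚ).geomPoints)
      (θ : (⟨0, 0, 0, 1, 0⟩ : WeierstrassCurve ℚ).geomPoints ≃+ (⟨0, 0, 0, 1, 0⟩ : WeierstrassCurve ℚ).geomPoints),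
      (∀ P, θ (θ P) = -P) ∧
      (∀ g : absoluteGaloisGroup ℚ, g • I = I → ∀ P, θ (g • P) = g • θ P) ∧
      ∀ g : absoluteGaloisGroup ℚ, g • I = I →
        (∀ P, ι (g • P) = g • ι P) ∨ (∀ P, ι (g • P) = -(g • ι P)) ∨
        (∀ P, θ (ι (g • P)) = g • ι P) ∨ (∀ P, ι (g • P) = θ (g • ι P)) := by
  set E₀ : WeierstrassCurve ℚ := ⟨0, 0, 0, 1, 0⟩ with hE₀
  have hI0 : I ≠ 0 := by rintro rfl; norm_num at hI
  have hI4 : I ^ 4 = 1 := by rw [show (4 : ℕ) = 2 * 2 by norm_num, pow_mul, hI]; norm_num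
  -- the automorphism θ
  set CI : VariableChange (AlgebraicClosure ℚ) := ⟨Units.mk0 I hI0, 0, 0, 0⟩ with hCIdef
  have hCIinv : ((Units.mk0 I hI0)⁻¹ : (AlgebraicClosure ℚ)ˣ) = Units.mk0 I⁻¹ (inv_ne_zero hI0) := Units.ext (by simp)
  have hCI : CI • E₀.baseChange (AlgebraicClosure ℚ) = E₀.baseChange (AlgebraicClosure ℚ) := by
    ext
    · simp [hCIdef, hE₀, baseChange, variableChange_a₁]
    · simp [hCIdef, hE₀, baseChange, variableChange_a₂]
    · simp [hCIdef, hE₀, baseChange, variableChange_a₃]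
    · simp only [hCIdef, hE₀, variableChange_a₄, baseChange, map_a₁, map_a₂, map_a₃, map_a₄, hCIinv, Units.val_mk0,
        map_zero, map_one, mul_zero, sub_zero, add_zero]
      rw [inv_pow, hI4]; norm_num
    · simp [hCIdef, hE₀, baseChange, variableChange_a₆]
  have hCIu : ((CI.u : (AlgebraicClosure ℚ)ˣ) : AlgebraicClosure ℚ) = I := by simp [hCIdef]
  let θ : E₀.geomPoints ≃+ E₀.geomPoints :=
    (VariableChange.pointEquiv (E₀.baseChange (AlgebraicClosure ℚ)) CI).trans (Affine.Point.congrEquiv hCI)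
  have hθθ : ∀ P, θ (θ P) = -P := fun P =>
    theta_theta (E := E₀) rfl rfl hI CI hCIu rfl rfl rfl hCI P
  have hθg : ∀ g : absoluteGaloisGroup ℚ, g • I = I → ∀ P, θ (g • P) = g • θ P := fun g hg P =>
    have h0g : g • (0 : AlgebraicClosure ℚ) = 0 := smul_zero g
    iso_smul (X := E₀) (E := E₀) CI hCI (by rw [hCIu]; exact hg) h0g h0g h0g P
  -- the short model `S₀ = [0,0,0,A,0]` of `W`
  have hjS : (W.toShortNF • W).j = 1728 := by rw [variableChange_j, hj]
  have hS6 : (W.toShortNF • W).a₆ = 0 := a₆_eq_zero_of_j_eq_1728 _ hjS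
  have hS4 : (W.toShortNF • W).a₄ ≠ 0 := by
    intro h0
    apply four_mul_a₄_cube_add_ne_zero (W.toShortNF • W)
    rw [h0, hS6]; ring
  set A : ℚ := (W.toShortNF • W).a₄ with hA
  set S₀ : WeierstrassCurve ℚ := ⟨0, 0, 0, A, 0⟩ with hS₀
  have hSA : W.toShortNF • W = S₀ := by
    rw [hS₀]; ext
    · exact a₁_of_isShortNF _
    · exact a₂_of_isShortNF _
    · exact a₃_of_isShortNF _
    · rfl
    · exact hS6
  -- `α⁴ = A`
  obtain ⟨α, hα⟩ := IsAlgClosed.exists_pow_nat_eq (algebraMap ℚ (AlgebraicClosure ℚ) A) (by norm_num : 0 < 4)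
  have hα0 : α ≠ 0 := by
    rintro rfl
    rw [zero_pow (by norm_num), eq_comm, map_eq_zero] at hα
    exact hS4 hα
  set C₁ : VariableChange (AlgebraicClosure ℚ) := ⟨Units.mk0 α hα0, 0, 0, 0⟩ with hC₁def
  have hC₁inv : ((Units.mk0 α hα0)⁻¹ : (AlgebraicClosure ℚ)ˣ) = Units.mk0 α⁻¹ (inv_ne_zero hα0) := Units.ext (by simp)
  have hC₁ : C₁ • S₀.baseChange (AlgebraicClosure ℚ) = E₀.baseChange (AlgebraicClosure ℚ) := by
    ext
    · simp [hC₁def, hE₀, hS₀, baseChange, variableChange_a₁]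
    · simp [hC₁def, hE₀, hS₀, baseChange, variableChange_a₂]
    · simp [hC₁def, hE₀, hS₀, baseChange, variableChange_a₃]
    · simp only [hC₁def, hE₀, hS₀, variableChange_a₄, baseChange, map_a₁, map_a₂, map_a₃, map_a₄, hC₁inv, Units.val_mk0,
        map_zero, map_one, mul_zero, sub_zero, add_zero]
      rw [← hα, inv_pow]
      field_simp
      ring
    · simp [hC₁def, hE₀, hS₀, baseChange, variableChange_a₆]
  let ι₁ : S₀.geomPoints ≃+ E₀.geomPoints :=
    (VariableChange.pointEquiv (S₀.baseChange (AlgebraicClosure ℚ)) C₁).trans (Affine.Point.congrEquiv hC₁)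
  let ιW : W.geomPoints ≃+ S₀.geomPoints := twistPointsIso hSA
  have hιW : ∀ (g : absoluteGaloisGroup ℚ) (P : W.geomPoints), ιW (g • P) = g • ιW P := fun g P => twistPointsIso_smul hSA g P
  refine ⟨ιW.trans ι₁, θ, hθθ, hθg, fun g hg => ?_⟩
  -- `g α = ζ α` with `ζ⁴ = 1`, so `ζ ∈ {1, -1, I, -I}`
  have hζ4 : (g • α) ^ 4 = α ^ 4 := by rw [← smul_pow', hα, smul_algebraMap]
  have hcases : g • α = α ∨ g • α = -α ∨ g • α = I * α ∨ g • α = -(I * α) := by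
    have hprod : (g • α - α) * (g • α + α) * ((g • α - I * α) * (g • α + I * α)) = 0 := by
      linear_combination hζ4 + (α ^ 4 - α ^ 2 * (g • α) ^ 2) * hI
    rcases mul_eq_zero.mp hprod with h12 | h34
    · rcases mul_eq_zero.mp h12 with h1 | h2
      · exact Or.inl (sub_eq_zero.mp h1)
      · exact Or.inr (Or.inl (add_eq_zero_iff_eq_neg.mp h2))
    · rcases mul_eq_zero.mp h34 with h3 | h4
      · exact Or.inr (Or.inr (Or.inl (sub_eq_zero.mp h3)))
      · exact Or.inr (Or.inr (Or.inr (add_eq_zero_iff_eq_neg.mp h4)))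
  have hu : ((C₁.u : (AlgebraicClosure ℚ)ˣ) : AlgebraicClosure ℚ) = α := by simp [hC₁def]
  have hr0 : C₁.r = 0 := rfl
  have hs0 : C₁.s = 0 := rfl
  have ht0 : C₁.t = 0 := rfl
  have h0g : g • (0 : AlgebraicClosure ℚ) = 0 := smul_zero g
  rcases hcases with h1 | h2 | h3 | h4
  · refine Or.inl fun P => ?_
    change ι₁ (ιW (g • P)) = g • ι₁ (ιW P)
    rw [hιW, show ι₁ (g • ιW P) = g • ι₁ (ιW P) from iso_smul C₁ hC₁ (by rw [hu]; exact h1) h0g h0g h0g _]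
  · refine Or.inr (Or.inl fun P => ?_)
    change ι₁ (ιW (g • P)) = -(g • ι₁ (ιW P))
    rw [hιW, show ι₁ (g • ιW P) = -(g • ι₁ (ιW P)) from iso_smul_neg C₁ hC₁ rfl rfl (by rw [hu]; exact h2) h0g h0g h0g _]
  · refine Or.inr (Or.inr (Or.inl fun P => ?_))
    change θ (ι₁ (ιW (g • P))) = g • ι₁ (ιW P)
    rw [hιW]
    exact iso_smul_quartic C₁ hC₁ hr0 hs0 ht0 hI CI hCIu rfl rfl rfl hCI (by rw [hu]; exact h3) _
  · refine Or.inr (Or.inr (Or.inr fun P => ?_))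
    change ι₁ (ιW (g • P)) = θ (g • ι₁ (ιW P))
    rw [hιW]
    exact iso_smul_quartic_neg C₁ hC₁ hr0 hs0 ht0 hI CI hCIu rfl rfl rfl hCI (by rw [hu]; exact h4) _

end Summit.BirchSwinnertonDyer.BirchSwinnertonDyer.Theorems.EtaCartanField

end
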